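import Summits.NavierStokesRegularity.NavierStokesRegularity.Theorems.TypeICertificateLadderStrainRateWeightedVorticity
import Summits.NavierStokesRegularity.NavierStokesRegularity.Theorems.TypeICertificateLadderRungReynoldsOneTaoCover
import Literature.Analysis.FluidPDE.AncientSimilarityVorticity
import Literature.Analysis.FluidPDE.NSVorticityBKMHolds
import HarnessLib

/-!
# Route TypeICertificateLadder — a generalised-Beltrami flow does not blow up (the singular-time
  twin of the cell's T33 endpoint / census class E25; helper of crux stmt-NavierStokesRegularity-2882)

If a classical Navier–Stokes solution (`ν > 0`) on `ℝ³ × [0, T)` in the Beale–Kato–Majda class is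
GENERALISED BELTRAMI on a final window `(t₀, T)` — its Lamb vector is curl free,
`curl (ω × u) ≡ 0` — then it continues in the class past `T`. Mechanism (folklore): for
divergence-free `u` and `ω = curl u`, `curl (ω × u) = Dω(u) − Du(ω)` (`curl_cross_apply`), so the
vorticity equation collapses to the HEAT equation `∂ₜω = νΔω`; Kato gives
`∂ₜ|ω|² = νΔ|ω|² − 2ν|∇ω|²_F ≤ νΔ|ω|²`, the whole-space maximum principle
(`le_of_subsolution_linear_drift_viscosity`, no drift) bounds `‖ω(t)‖_∞` by `‖ω(t₀)‖_∞`, and the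
Beale–Kato–Majda criterion (`beale_kato_majda_holds`) continues the solution. Contrapositively: at
a singular time the Lamb vector fails to be curl free somewhere, frequently as `t ↑ T` — every
hypothetical blow-up is NON-Beltrami all the way to the singular time (compare the ancient side:
`SimilarityEnstrophy.typeI_ancient_eq_zero_of_generalisedBeltrami`, the typed T33 endpoint).

* `vorticity_sq_le_of_generalisedBeltrami` — the a-priori bound;
* `hasSobolevExtensionPast_of_generalisedBeltrami` — continuation;
* `curl_lamb_ne_zero_frequently_of_not_hasSobolevExtensionPast`,
  `typeICertificateLadder_curl_lamb_ne_zero_frequently` — the singular-time phrasings.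

HONEST FRAMING: statements about a HYPOTHETICAL singular time; nothing here bears on the regularity
question itself. Lands `--supports stmt-NavierStokesRegularity-2882`.
-/

noncomputable section

namespace Summit.NavierStokesRegularity.NavierStokesRegularity.Theorems

set_option linter.dupNamespace false

open MeasureTheory Set Filter Topology Function
open scoped RealInnerProductSpace Laplacian ContDiff
open Literature.Analysis Literature.Analysis.FluidPDE

/-- **The vorticity of a generalised-Beltrami window is bounded by its initial supremum.** Let
`(u, p)` be a classical Navier–Stokes solution (`ν > 0`) on `ℝ³ × [0,T)` in the BKM class on every
`[0,T'']`, `T'' < T`, with `curl (ω × u)(t, x) = 0` for all `x` and `t ∈ (t₀, T)` (`0 < t₀ < T`). Then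
`‖ω(t,x)‖² ≤ (‖curlCLM‖ sup‖∇u(t₀)‖)²` on `[t₀, T) × ℝ³`: the vorticity equation is `∂ₜω = νΔω`
(`curl_cross_apply` + incompressibility), `|ω|²` is a bounded subsolution of the heat equation, and
`le_of_subsolution_linear_drift_viscosity` applies with zero drift. [folklore] -/
theorem vorticity_sq_le_of_generalisedBeltrami {ν T t₀ : ℝ} (hν : 0 < ν) (ht₀ : 0 < t₀) (ht₀T : t₀ < T)
    {u : ℝ → EuclideanSpace ℝ (Fin 3) → EuclideanSpace ℝ (Fin 3)}
    {p : ℝ → EuclideanSpace ℝ (Fin 3) → ℝ}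
    (hsol : IsClassicalNSSolutionOn (Ico 0 T) ν 0 u p)
    (hreg : ∀ T'' < T, HasBoundedSobolevNormsOn (Icc 0 T'') u)
    (hbel : ∀ t ∈ Ioo t₀ T, ∀ x, curl (fun y => cross (curl (u t) y) (u t y)) x = 0) :
    ∃ M : ℝ, ∀ t ∈ Ico t₀ T, ∀ x, ‖curl (u t) x‖ ^ 2 ≤ M := by
  -- the solution on the open slab and its vorticity equation (two-sided time derivative)
  have hsolo : IsClassicalNSSolutionOn (Ioo 0 T) ν 0 u p :=
    hsol.mono Ioo_subset_Ico_self isOpen_Ioo.uniqueDiffOn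
  have hsm : IsSmoothSpaceTimeOn (Ioo 0 T) u := hsolo.smooth_velocity
  have hvort : IsSmoothSpaceTimeOn (Ioo 0 T) (vorticity u) := by
    have h1 := (hsm.isSmoothSpaceTimeOn_fderiv_of_isOpen isOpen_Ioo).clm curlCLM
    have e : (fun t x => curlCLM (fderiv ℝ (u t) x)) = vorticity u := by funext s y; rfl
    rwa [e] at h1
  have hV := hsolo.isVorticitySolutionOn_zero_force isOpen_Ioo.uniqueDiffOn
    (by rw [interior_Ioo]; exact subset_closure)
  -- under the Beltrami hypothesis the vorticity equation is the heat equation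
  have hheat : ∀ t ∈ Ioo t₀ T, ∀ x,
      deriv (fun s => curl (u s) x) t = ν • (Δ (curl (u t))) x := by
    intro t ht x
    have ht' : t ∈ Ioo 0 T := ⟨ht₀.trans ht.1, ht.2⟩
    have h := hV.vorticity_eq t ht' x
    simp only [timeDerivWithin_eq_deriv isOpen_Ioo ht', convect_apply, vorticity_apply] at h
    -- `Dω(u) = Du(ω)` from `curl (ω × u) = 0`, `div u = 0`, `div ω = 0`
    have hu3 : ContDiff ℝ 3 (u t) := (hsol.contDiff_velocity ⟨ht'.1.le, ht'.2⟩).of_le (by norm_cast)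
    have hω2 : ContDiff ℝ 2 (curl (u t)) := contDiff_curl hu3
    have hdω : DifferentiableAt ℝ (curl (u t)) x := (hω2.differentiable (by norm_num)) x
    have hdu : DifferentiableAt ℝ (u t) x := (hu3.differentiable (by norm_num)) x
    have hb := hbel t ht x
    rw [curl_cross_apply hdω hdu, hsol.divFree t ⟨ht'.1.le, ht'.2⟩ x,
      divergence_curl_eq_zero_holds _ (hu3.of_le (by norm_cast)) x, zero_smul, zero_smul,
      sub_zero, add_zero, sub_eq_zero] at hb
    -- `hb : Dω(u) = Du(ω)`
    rw [hb] at h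
    exact add_right_cancel (h.trans (by rw [add_comm]))
  -- sup bounds from the BKM class
  have hsmooth : ∀ t ∈ Ico 0 T, ContDiff ℝ ∞ (u t) := fun t ht => hsol.contDiff_velocity ht
  set κ₀ : ℝ := ‖(curlCLM : (EuclideanSpace ℝ (Fin 3) →L[ℝ] EuclideanSpace ℝ (Fin 3)) →L[ℝ]
    EuclideanSpace ℝ (Fin 3))‖ with hκ₀
  have hκ₀0 : 0 ≤ κ₀ := by rw [hκ₀]; positivity
  have hcurl_le : ∀ (f : EuclideanSpace ℝ (Fin 3) → EuclideanSpace ℝ (Fin 3)) (x),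
      ‖curl f x‖ ≤ κ₀ * ‖iteratedFDeriv ℝ 1 f x‖ := fun f x => by
    rw [curl_eq_curlCLM, ← norm_iteratedFDeriv_fderiv, norm_iteratedFDeriv_zero]
    exact ContinuousLinearMap.le_opNorm _ _
  obtain ⟨B₁, hB₁0, hB₁⟩ := exists_forall_norm_iteratedFDeriv_le_bkmClass
    (fun t ht => hsmooth t ⟨ht.1, ht.2.trans_lt ht₀T⟩) (hreg t₀ ht₀T) 1
  set M : ℝ := (κ₀ * B₁) ^ 2 with hMdef
  refine ⟨M, fun t ht x => ?_⟩
  have hPt₀ : ∀ y, ‖curl (u t₀) y‖ ^ 2 ≤ M := fun y =>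
    pow_le_pow_left₀ (norm_nonneg _)
      ((hcurl_le _ y).trans (mul_le_mul_of_nonneg_left (hB₁ t₀ ⟨ht₀.le, le_rfl⟩ y) hκ₀0)) 2
  rcases ht.1.eq_or_lt with rfl | ht₀t
  · exact hPt₀ x
  -- the maximum principle on `[t₀, T₂]`, `T₂ = t`, with zero drift
  set T₂ : ℝ := t with hT₂
  have hT₂T : T₂ < T := ht.2
  obtain ⟨B₂, hB₂0, hB₂⟩ := exists_forall_norm_iteratedFDeriv_le_bkmClass
    (fun s hs => hsmooth s ⟨hs.1, hs.2.trans_lt hT₂T⟩) (hreg T₂ hT₂T) 1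
  have hωB : ∀ s ∈ Icc 0 T₂, ∀ y, ‖curl (u s) y‖ ≤ κ₀ * B₂ := fun s hs y =>
    (hcurl_le _ y).trans (mul_le_mul_of_nonneg_left (hB₂ s hs y) hκ₀0)
  set P : ℝ → EuclideanSpace ℝ (Fin 3) → ℝ := fun s y => ‖curl (u s) y‖ ^ 2 with hPdef
  set Pₜ : ℝ → EuclideanSpace ℝ (Fin 3) → ℝ := fun s y =>
    2 * ⟪curl (u s) y, deriv (fun σ => curl (u σ) y) s⟫ with hPₜdef
  have hIoc_sub : ∀ {s}, s ∈ Ioc t₀ T₂ → s ∈ Ioo 0 T := fun {s} hs =>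
    ⟨ht₀.trans hs.1, hs.2.trans_lt hT₂T⟩
  have hIcc_sub : ∀ {s}, s ∈ Icc t₀ T₂ → s ∈ Ioo 0 T := fun {s} hs =>
    ⟨ht₀.trans_le hs.1, hs.2.trans_lt hT₂T⟩
  have key := le_of_subsolution_linear_drift_viscosity (T₁ := t₀) (T₂ := T₂) (M := M)
    (B := (κ₀ * B₂) ^ 2) (K := 0) (P := P) (Pₜ := Pₜ) hν le_rfl ?_ ?_ ?_ ?_ ?_ ?_
  · exact key t ⟨ht₀t.le, le_rfl⟩ x
  · -- joint continuity
    have hωc : ContinuousOn (fun z : ℝ × EuclideanSpace ℝ (Fin 3) => ‖vorticity u z.1 z.2‖ ^ 2)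
        (Icc t₀ T₂ ×ˢ univ) := by
      refine ((hvort.continuousOn.mono ?_).norm).pow 2
      exact prod_mono (fun s hs => hIcc_sub hs) subset_rfl
    refine hωc.congr fun z _ => ?_
    simp only [hPdef, uncurry, vorticity_apply]
  · -- `C²` slices
    intro s hs
    have hω : ContDiff ℝ 2 (curl (u s)) := by
      rw [← vorticity_apply]
      exact (hvort.contDiff_slice (hIoc_sub hs)).of_le (by norm_cast)
    exact hω.norm_sq ℝ
  · -- time derivative
    intro s hs y
    have hωt : HasDerivAt (fun σ => curl (u σ) y) (deriv (fun σ => curl (u σ) y) s) s := by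
      have h := hvort.hasDerivAt_timeLine isOpen_Ioo (hIoc_sub hs) y
      simpa only [vorticity_apply] using h
    exact hωt.norm_sq
  · -- the subsolution inequality `Pₜ ≤ ν ΔP`
    intro s hs y
    have hs' := hIoc_sub hs
    have hω2 : ContDiff ℝ 2 (curl (u s)) := by
      rw [← vorticity_apply]
      exact (hvort.contDiff_slice hs').of_le (by norm_cast)
    have hLap : (Δ (P s)) y = 2 * ⟪(Δ (curl (u s))) y, curl (u s) y⟫ +
        2 * frobeniusNormSq (fderiv ℝ (curl (u s)) y) := laplacian_norm_sq_comp hω2 y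
    have hfrob := frobeniusNormSq_nonneg (fderiv ℝ (curl (u s)) y)
    show Pₜ s y ≤ ν * (Δ (P s)) y + 0 * (1 + ‖y‖) * ‖fderiv ℝ (P s) y‖
    have e1 : Pₜ s y = 2 * ⟪curl (u s) y, deriv (fun σ => curl (u σ) y) s⟫ := rfl
    rw [e1, hheat s ⟨hs.1, hs'.2⟩ y, hLap, real_inner_smul_right, real_inner_comm]
    nlinarith [hν.le, hfrob]
  · -- bounded above
    intro s hs y
    exact pow_le_pow_left₀ (norm_nonneg _) (hωB s ⟨(hIcc_sub hs).1.le, hs.2⟩ y) 2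
  · exact hPt₀

/-- **A generalised-Beltrami final window continues past `T`.** Let `(u, p)` be a classical
Navier–Stokes solution (`ν > 0`) on `ℝ³ × [0,T)`, `T > 0`, with all `L²` Sobolev norms bounded on
every `[0,T'']`, `T'' < T`, and suppose `curl (ω × u) ≡ 0` on `(t₀, T) × ℝ³` for some `t₀ < T`. Then
the solution continues in the class past `T` (`HasSobolevExtensionPast`): the vorticity is bounded
on `(0, T)` (`vorticity_sq_le_of_generalisedBeltrami` + the sup bounds on `[0, t₀]`), so
`∫₀ᵀ ‖ω‖_∞ < ∞` and the Beale–Kato–Majda criterion (`beale_kato_majda_holds`) applies. [folklore] -/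
theorem hasSobolevExtensionPast_of_generalisedBeltrami {ν T t₀ : ℝ} (hν : 0 < ν) (hT : 0 < T)
    (ht₀T : t₀ < T)
    {u : ℝ → EuclideanSpace ℝ (Fin 3) → EuclideanSpace ℝ (Fin 3)}
    {p : ℝ → EuclideanSpace ℝ (Fin 3) → ℝ}
    (hsol : IsClassicalNSSolutionOn (Ico 0 T) ν 0 u p)
    (hreg : ∀ T'' < T, HasBoundedSobolevNormsOn (Icc 0 T'') u)
    (hbel : ∀ t ∈ Ioo t₀ T, ∀ x, curl (fun y => cross (curl (u t) y) (u t y)) x = 0) :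
    HasSobolevExtensionPast ν u T := by
  -- a positive window start `t₁ = max t₀ (T/2)`
  set t₁ : ℝ := max t₀ (T / 2) with ht₁
  have ht₁0 : 0 < t₁ := lt_of_lt_of_le (by linarith) (le_max_right _ _)
  have ht₁T : t₁ < T := max_lt ht₀T (by linarith)
  have hbel' : ∀ t ∈ Ioo t₁ T, ∀ x, curl (fun y => cross (curl (u t) y) (u t y)) x = 0 :=
    fun t ht => hbel t ⟨lt_of_le_of_lt (le_max_left _ _) ht.1, ht.2⟩
  obtain ⟨M, hM⟩ := vorticity_sq_le_of_generalisedBeltrami hν ht₁0 ht₁T hsol hreg hbel'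
  have hM0 : 0 ≤ M := le_trans (sq_nonneg _) (hM t₁ ⟨le_rfl, ht₁T⟩ 0)
  -- the bound on `[0, t₁]`
  have hsmooth : ∀ t ∈ Ico 0 T, ContDiff ℝ ∞ (u t) := fun t ht => hsol.contDiff_velocity ht
  obtain ⟨B₁, hB₁0, hB₁⟩ := exists_forall_norm_iteratedFDeriv_le_bkmClass
    (fun t ht => hsmooth t ⟨ht.1, ht.2.trans_lt ht₁T⟩) (hreg t₁ ht₁T) 1
  set κ₀ : ℝ := ‖(curlCLM : (EuclideanSpace ℝ (Fin 3) →L[ℝ] EuclideanSpace ℝ (Fin 3)) →L[ℝ]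
    EuclideanSpace ℝ (Fin 3))‖ with hκ₀
  have hκ₀0 : 0 ≤ κ₀ := by rw [hκ₀]; positivity
  have hcurl_le : ∀ (f : EuclideanSpace ℝ (Fin 3) → EuclideanSpace ℝ (Fin 3)) (x),
      ‖curl f x‖ ≤ κ₀ * ‖iteratedFDeriv ℝ 1 f x‖ := fun f x => by
    rw [curl_eq_curlCLM, ← norm_iteratedFDeriv_fderiv, norm_iteratedFDeriv_zero]
    exact ContinuousLinearMap.le_opNorm _ _
  set Kc : ℝ := max (κ₀ * B₁) (Real.sqrt M) with hKc
  have hbound : ∀ t ∈ Ioo 0 T, ∀ x, ‖curl (u t) x‖ ≤ Kc := by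
    intro t ht x
    rcases lt_or_ge t t₁ with hlt | hge
    · exact ((hcurl_le _ x).trans (mul_le_mul_of_nonneg_left (hB₁ t ⟨ht.1.le, hlt.le⟩ x) hκ₀0)).trans
        (le_max_left _ _)
    · have h1 := hM t ⟨hge, ht.2⟩ x
      have h2 : ‖curl (u t) x‖ ≤ Real.sqrt M := by
        rw [← Real.sqrt_sq (norm_nonneg (curl (u t) x))]
        exact Real.sqrt_le_sqrt h1
      exact h2.trans (le_max_right _ _)
  have hfin : (∫⁻ t in Ioo 0 T, ⨆ x, ‖curl (u t) x‖ₑ) < ⊤ := by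
    have hconst : (∫⁻ _ in Ioo 0 T, ENNReal.ofReal Kc) < ⊤ := by
      rw [setLIntegral_const]
      exact ENNReal.mul_lt_top ENNReal.ofReal_lt_top (by simp [Real.volume_Ioo])
    refine lt_of_le_of_lt (setLIntegral_mono' measurableSet_Ioo fun t ht => ?_) hconst
    refine iSup_le fun x => ?_
    rw [← ofReal_norm]
    exact ENNReal.ofReal_le_ofReal (hbound t ht x)
  exact (beale_kato_majda_holds hν.le hT hsol hreg).2 hfin

/-- **At a singular time the Lamb vector is not curl free, frequently.** Let `(u, p)` be a classical
Navier–Stokes solution (`ν > 0`) on `ℝ³ × [0,T)` in the BKM class which cannot be continued in the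
class past `T`. Then frequently as `t ↑ T` there is a point with `curl (ω × u)(t, x) ≠ 0`: no
hypothetical blow-up is generalised Beltrami up to the singular time (the singular-time twin of the
cell's typed T33 endpoint on the ancient side). [this file] -/
theorem curl_lamb_ne_zero_frequently_of_not_hasSobolevExtensionPast {ν T : ℝ} (hν : 0 < ν)
    (hT : 0 < T) {u : ℝ → EuclideanSpace ℝ (Fin 3) → EuclideanSpace ℝ (Fin 3)}
    {p : ℝ → EuclideanSpace ℝ (Fin 3) → ℝ}
    (hsol : IsClassicalNSSolutionOn (Ico 0 T) ν 0 u p)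
    (hreg : ∀ T'' < T, HasBoundedSobolevNormsOn (Icc 0 T'') u)
    (hmax : ¬ HasSobolevExtensionPast ν u T) :
    ∃ᶠ t in 𝓝[<] T, ∃ x, curl (fun y => cross (curl (u t) y) (u t y)) x ≠ 0 := by
  by_contra h
  simp only [Filter.not_frequently, not_exists, not_not] at h
  obtain ⟨t₀, ht₀T, ht₀⟩ := mem_nhdsLT_iff_exists_Ioo_subset.1 h
  exact hmax (hasSobolevExtensionPast_of_generalisedBeltrami hν hT ht₀T hsol hreg
    fun t ht x => ht₀ ht x)

/-- **Fefferman / Leray–Hopf class: a hypothetical blow-up is non-Beltrami up to the singular time.**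
A classical solution of unforced Navier–Stokes (`ν, T > 0`) on `ℝ³ × [0,T)`, Leray–Hopf on `[0,T]`
from its rapidly decaying datum, with no smooth extension past `T`, has `curl (ω × u)(t, x) ≠ 0` for
some `x`, frequently as `t ↑ T` (BKM class from the landed `stub_taoCover`). [this file] -/
theorem typeICertificateLadder_curl_lamb_ne_zero_frequently {ν T : ℝ} (hν : 0 < ν) (hT : 0 < T)
    {u : ℝ → EuclideanSpace ℝ (Fin 3) → EuclideanSpace ℝ (Fin 3)}
    {p : ℝ → EuclideanSpace ℝ (Fin 3) → ℝ}
    (hsol : IsClassicalNSSolutionOn (Ico 0 T) ν 0 u p) (hLH : IsLerayHopfOn T ν 0 (u 0) u)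
    (hdec : HasRapidSpatialDecay (u 0)) (hsing : ¬ HasSmoothExtensionPast ν 0 u T) :
    ∃ᶠ t in 𝓝[<] T, ∃ x, curl (fun y => cross (curl (u t) y) (u t y)) x ≠ 0 := by
  have hreg : ∀ T'' < T, HasBoundedSobolevNormsOn (Icc 0 T'') u := by
    intro T'' hT''
    set T' : ℝ := max T'' (T / 2) with hT'
    have hT'm : T' ∈ Ioo 0 T :=
      ⟨lt_of_lt_of_le (by linarith) (le_max_right _ _), max_lt hT'' (by linarith)⟩
    obtain ⟨q, -, hB, -, -⟩ := RungReynoldsOne.stub_taoCover hν hT hsol hLH hdec hT'm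
    exact hB.mono (Icc_subset_Icc_right (le_max_left _ _))
  exact curl_lamb_ne_zero_frequently_of_not_hasSobolevExtensionPast hν hT hsol hreg
    fun h => hsing h.hasSmoothExtensionPast

end Summit.NavierStokesRegularity.NavierStokesRegularity.Theorems

end
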